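import Summits.QuantumAdvantage.QuantumAdvantage.Theorems.CubicForrelationNearExactIsExactTwelveTypeO934Wild
import Summits.QuantumAdvantage.QuantumAdvantage.Theorems.CubicForrelationNearExactIsExactTwelveTypeO934Period

/-!
# Crux `CubicForrelation.NearExactIsExact` (stmt-QuantumAdvantage-14043) — n = 12: a type-O side has `Φ < 934/1024`

Certificate seat `b2b-cforr-cert` (gen 18).  HONEST FRAMING: a kernel-checked theorem (standard axioms, no `decide`/`native_decide`) about cubic
Boolean pairs on 12 bits — the type-O half of the rung `934/1024` of the finite slice `n = 12`; the level-`≥ 6` half at `934` is NOT in this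
file, so NO new value of `θ₁₂` is claimed here.  NOT summit progress.

Proof (`to18_typeO_ge934_false`).  By `to18_typeO_ge934_wild` the wild function `v` of a type-O side `g` at `Φ ≥ 934/1024` is
`(−1)^{b₁}(−1)^{c₁·x}` on an 8-point set `S ⊆ E` (`#E = 912`) and `0` elsewhere, so `v̂(y) = (−1)^{b₁} Ŝ(c₁ ⊕ y)` with
`Ŝ(z) = Σ_{x∈S}(−1)^{x·z} ∈ {0, ±8}` (`to18_typeO_vhat_dvd8`).  The partner identity at `y = c₁` gives `u_f(c₁) = 4(−1)^{g(c₁)} − 8(−1)^{b₁}`,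
an even value `≡ 4 (mod 8)`: the partner `f` is neither type O (`typeO_of_exists_odd`) nor at level 5 (`tw15_levelFive_932_false`), so
`4 ∣ u_f`; reducing the partner identity modulo `256` then gives `Ê(z) ≡ 2Ŝ(z) (mod 64)`.  Where `Ŝ(z) = 0`, `z ≠ 0`, the half weights of `E`
along `z` are cubic weights on 11 bits `≡ 8 (mod 32)`, hence both `456` and `Ê(z) = 0` (`to18_char_sum_912_dvd64`); where `Ŝ(z) = ±8` all of `S`
lies on one side of `z`, so `(−1)^{a·z} = 1` for every difference `a = x₁ ⊕ x₂` of points of `S`.  By Walsh inversion `E ⊕ a = E` for all such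
`a`; two distinct non-zero differences contradict `to18_no_two_periods_912`.
References: Ax (1964) / McEliece (1972); Kasami–Tokura (1970) only through the tree's gap lemma `to18_cubic_weights_eleven`;
MacWilliams–Sloane (1977) Ch. 15.  Axioms: the standard three.
-/

set_option linter.dupNamespace false -- D-0017: single-problem summit ⇒ `QuantumAdvantage.QuantumAdvantage` by design

noncomputable section

namespace Summit.QuantumAdvantage.QuantumAdvantage.Theorems.CubicForrelation.NearExactIsExact

open Finset
open Literature.Computability.QuantumComplexity
open Literature.Computability.QuantumComplexity.BuzetChailloux (bxor zeroVec bxor_bxor_cancel_left bxor_zeroVec zeroVec_bxor bxor_comm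
  bxor_self twist_zeroVec_right twist_bxor_right signOf_sq)
open Literature.Computability.QuantumComplexity.DerivativeWalsh (W sum_W_sq)
open Literature.Computability.QuantumComplexity.Simon (twist_eq_one_or)
open Summit.QuantumAdvantage.QuantumAdvantage.Theorems.NearExactIsExact.Negative (TypeOTwelve.typeO_of_exists_odd)

/-! ### Character sums over a `912`-point cubic support that are multiples of `64` vanish -/

/-- **`Ê(z) ∈ 64ℤ ⇒ Ê(z) = 0`** for a cubic support of `912` points on 12 bits and `z ≠ 0`: the two half weights along `z` are cubic weights on
11 bits (`ktg_restrict`), multiples of `8` in `{0, 256, 384} ∪ [448, ∞)`, adding up to `912` and `≡ 8 (mod 32)` — so both are `456`.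
NOT summit progress. [this work] -/
theorem to18_char_sum_912_dvd64 (c : (Fin (6 + 6) → Bool) → Bool) (hc : IsDegLeFun 3 c) (h912 : #(univ.filter fun x => c x = true) = 912)
    (z : Fin (6 + 6) → Bool) (hz : ∃ i, z i = true) (m : ℤ)
    (hm : ∑ x ∈ univ.filter (fun x => c x = true), twist x z = 64 * (m : ℝ)) :
    ∑ x ∈ univ.filter (fun x => c x = true), twist x z = 0 := by
  classical
  obtain ⟨i₀, hi₀⟩ := hz
  set A := #(univ.filter fun x : Fin (6 + 6) → Bool =>
    c x = true ∧ decide (Odd #(univ.filter fun i => (x i && z i) = true)) = true) with hAdef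
  set B := #(univ.filter fun x : Fin (6 + 6) → Bool =>
    c x = true ∧ decide (Odd #(univ.filter fun i => (x i && z i) = true)) = false) with hBdef
  have hF := ktg_F_half c z
  rw [h912] at hF
  have hAB : A + B = 912 := by have h := ktg_half_add c z; rw [h912] at h; exact h
  obtain ⟨cT, hcT, hcardT⟩ := ktg_restrict (k := 11) c hc z i₀ hi₀ true
  obtain ⟨cF, hcF, hcardF⟩ := ktg_restrict (k := 11) c hc z i₀ hi₀ false
  have hA8 := to18_cubic_weight_eleven_dvd cT hcT
  have hB8 := to18_cubic_weight_eleven_dvd cF hcF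
  have hAw := to18_cubic_weights_eleven cT hcT
  have hBw := to18_cubic_weights_eleven cF hcF
  rw [hcardT] at hA8 hAw
  rw [hcardF] at hB8 hBw
  change 8 ∣ A at hA8
  change 8 ∣ B at hB8
  change A = 0 ∨ A = 256 ∨ A = 384 ∨ 448 ≤ A at hAw
  change B = 0 ∨ B = 256 ∨ B = 384 ∨ 448 ≤ B at hBw
  have hAm : (912 : ℤ) - 2 * A = 64 * m := by
    rw [hF] at hm
    exact_mod_cast hm
  have hA456 : A = 456 := by omega
  rw [hF, ← hAdef, hA456]; norm_num

/-! ### The theorem -/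

/-- **A type-O side is impossible for `Φ ≥ 934/1024` on 12 bits.**  See the module docstring.  Finite-slice statement; NOT summit progress.
[this work] -/
theorem to18_typeO_ge934_false (f g : (Fin (6 + 6) → Bool) → Bool) (hf : IsDegLeFun 3 f) (hg : IsDegLeFun 3 g)
    (u : (Fin (6 + 6) → Bool) → ℤ) (hu : ∀ x, W (fun y => signOf (g y)) x = (2 : ℝ) ^ 4 * (u x : ℝ))
    (hodd : ∃ x, Odd (u x)) (hΦ : (934 / 1024 : ℝ) ≤ forrelation f g) : False := by
  classical
  -- digits and base set
  have hall : ∀ x, Odd (u x) := TypeOTwelve.typeO_of_exists_odd g u hg hu hodd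
  have hu' : ∀ x, W (fun y => signOf (g y)) x = (2 : ℝ) ^ (2 * 2) * (u x : ℝ) := fun x => (hu x).trans (by norm_num)
  have hd1 : IsDegLeFun 1 (fun x => decide (Odd (u x / 2))) := z2_digitOne 2 g u hg hu' hall
  have hd2 : IsDegLeFun 3 (fun x => decide (Odd (u x / 2 / 2))) := z2_digitTwo 2 g u hg hu' hall
  set cE : (Fin (6 + 6) → Bool) → Bool := fun x => (decide (Odd (u x / 2)) ^^ decide (Odd (u x / 2 / 2))) ^^ true with hcEdef
  have hcE3 : IsDegLeFun 3 cE := tb_isDegLeFun_xor_const (bb_isDegLeFun_bxor (hd1.mono (by norm_num)) hd2) true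
  have hcEiff : ∀ x, cE x = true ↔ (Odd (u x / 2) ↔ Odd (u x / 2 / 2)) := by
    intro x; simp only [cE]; by_cases h1 : Odd (u x / 2) <;> by_cases h2 : Odd (u x / 2 / 2) <;> simp [h1, h2]
  have hsetE : (univ.filter fun x => cE x = true) = univ.filter fun x : Fin (6 + 6) → Bool => (Odd (u x / 2) ↔ Odd (u x / 2 / 2)) :=
    filter_congr fun x _ => hcEiff x
  obtain ⟨hE, -⟩ := to18_typeO_ge934_shape f g hf hg u hu hodd hΦ
  have hcEcard : #(univ.filter fun x => cE x = true) = 912 := by rw [hsetE, hE]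
  -- wild function, affine digit, partner, wild set
  choose v hv using fun x => to12_pt_mod8 (u x) (sZ (f x)) (hall x) (tp_sZ_cases (f x))
  obtain ⟨c₁, b₁, hcb⟩ := stub_affineForm (6 + 6) _ hd1
  obtain ⟨uf, huf⟩ := tw_base (n := 6 + 6) f hf 4 (by norm_num)
  obtain ⟨hv8, hwild⟩ := to18_typeO_ge934_wild f g hf hg u hu hodd hΦ v hv c₁ b₁ hcb
  have hsb : signOf b₁ = 1 ∨ signOf b₁ = -1 := by cases b₁ <;> simp [signOf]
  have hsb2 : signOf b₁ * signOf b₁ = (1 : ℝ) := by rcases hsb with h | h <;> rw [h] <;> norm_num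
  set S := univ.filter (fun x : Fin (6 + 6) → Bool => v x ≠ 0) with hSdef
  have hSv : ∀ x ∈ S, (Odd (u x / 2) ↔ Odd (u x / 2 / 2)) ∧ (v x : ℝ) = signOf b₁ * twist c₁ x := by
    intro x hx
    rw [mem_filter] at hx
    rcases hwild x with h | h
    · exact absurd h hx.2
    · exact h
  have hoff : ∀ x ∈ univ.filter (fun x : Fin (6 + 6) → Bool => ¬ v x ≠ 0), v x = 0 := fun x hx => by
    rw [mem_filter] at hx; by_contra h; exact hx.2 h
  have hS8 : #S = 8 := by
    have h1 : ∀ x ∈ S, v x ^ 2 = 1 := by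
      intro x hx
      have h' : ((v x : ℝ)) ^ 2 = 1 := by
        rw [(hSv x hx).2, mul_pow]
        rcases hsb with hs | hs <;> rcases twist_eq_one_or c₁ x with ht | ht <;> rw [hs, ht] <;> norm_num
      exact_mod_cast h'
    have h : ∑ x, v x ^ 2 = ∑ x ∈ S, v x ^ 2 := by
      rw [← sum_filter_add_sum_filter_not univ (fun x => v x ≠ 0),
        sum_eq_zero (s := univ.filter fun x => ¬ v x ≠ 0) (fun x hx => by rw [hoff x hx]; ring), add_zero]
    rw [hv8, sum_congr rfl h1, sum_const, nsmul_eq_mul, mul_one] at h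
    exact_mod_cast h.symm
  -- `v̂(y) = (−1)^{b₁} Ŝ(c₁ ⊕ y)`, `Ŝ ∈ {0, ±8}`
  have hvhat : ∀ y, ∑ x, (v x : ℝ) * twist x y = signOf b₁ * ∑ x ∈ S, twist x (bxor c₁ y) := by
    intro y
    rw [← sum_filter_add_sum_filter_not univ (fun x => v x ≠ 0),
      sum_eq_zero (s := univ.filter fun x => ¬ v x ≠ 0) (fun x hx => by rw [hoff x hx]; simp), add_zero, mul_sum]
    refine sum_congr rfl fun x hx => ?_
    rw [(hSv x hx).2, twist_bxor_right, twist_comm x c₁]; ring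
  have habsS : ∀ z, |∑ x ∈ S, twist x z| ≤ 8 := by
    intro z
    refine (abs_sum_le_sum_abs _ _).trans ?_
    rw [sum_congr rfl fun x _ => show |twist x z| = (1 : ℝ) by rcases twist_eq_one_or x z with h | h <;> rw [h] <;> norm_num,
      sum_const, hS8]
    norm_num
  have hShat : ∀ z, ∑ x ∈ S, twist x z = 0 ∨ ∑ x ∈ S, twist x z = 8 ∨ ∑ x ∈ S, twist x z = -8 := by
    intro z
    obtain ⟨K, hK⟩ := to18_typeO_vhat_dvd8 f g hg u hu hodd hE v hv c₁ b₁ hcb uf huf (bxor c₁ z)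
    rw [hvhat, bxor_bxor_cancel_left] at hK
    have hŜ : ∑ x ∈ S, twist x z = 8 * (signOf b₁ * K) := by
      have h : signOf b₁ * (signOf b₁ * ∑ x ∈ S, twist x z) = signOf b₁ * (8 * K) := by rw [hK]
      rw [← mul_assoc, hsb2, one_mul] at h
      rw [h]; ring
    have hb := habsS z
    rw [hŜ] at hb
    have hK1 : |(K : ℝ)| ≤ 1 := by
      rw [abs_mul, abs_mul] at hb
      rcases hsb with hs | hs <;> rw [hs] at hb <;> norm_num at hb <;> linarith
    have hK1' : -1 ≤ K ∧ K ≤ 1 := by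
      rw [abs_le] at hK1
      exact ⟨by exact_mod_cast hK1.1, by exact_mod_cast hK1.2⟩
    have hKc : K = -1 ∨ K = 0 ∨ K = 1 := by omega
    rw [hŜ]
    rcases hKc with h | h | h <;> rcases hsb with hs | hs <;> rw [h, hs] <;> norm_num
  -- the partner: `u_f(c₁) = 4(−1)^{g(c₁)} − 8(−1)^{b₁}`, so `f` is neither type O nor at level 5: `4 ∣ u_f`
  have hid := to18_typeO_partner_identity f g u hu v hv c₁ b₁ hcb uf huf
  have hufc₁ : (uf c₁ : ℝ) = 4 * signOf (g c₁) - 8 * signOf b₁ := by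
    have h := hid c₁
    have h0 : bxor c₁ c₁ = (fun _ => false) := bxor_self c₁
    rw [if_pos h0, hvhat c₁, bxor_self] at h
    have e1 : ∑ x ∈ univ.filter (fun x : Fin (6 + 6) → Bool => (Odd (u x / 2) ↔ Odd (u x / 2 / 2))), twist x zeroVec = 912 := by
      rw [sum_congr rfl fun x _ => twist_zeroVec_right x, sum_const, hE]; norm_num
    have e2 : ∑ x ∈ S, twist x zeroVec = 8 := by rw [sum_congr rfl fun x _ => twist_zeroVec_right x, sum_const, hS8]; norm_num
    rw [e1, e2, show (2 : ℝ) ^ (6 + 6) = 4096 by norm_num] at h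
    linarith [hsb2]
  have hufZ : uf c₁ = 4 * sZ (g c₁) - 8 * sZ b₁ := by
    have h' : ((uf c₁ : ℤ) : ℝ) = ((4 * sZ (g c₁) - 8 * sZ b₁ : ℤ) : ℝ) := by push_cast; rw [tp_sZ_cast, tp_sZ_cast]; exact hufc₁
    exact_mod_cast h'
  have hfev : ∀ y, ¬ Odd (uf y) := by
    intro y hy
    have h1 := TypeOTwelve.typeO_of_exists_odd f uf hf huf ⟨y, hy⟩ c₁
    rw [hufZ] at h1
    rcases tp_sZ_cases (g c₁) with h | h <;> rcases tp_sZ_cases b₁ with h' | h' <;> rw [h, h'] at h1 <;> revert h1 <;> decide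
  have huf5 : ∀ x, W (fun y => signOf (f y)) x = (2 : ℝ) ^ 5 * (((uf x / 2 : ℤ)) : ℝ) := fun x =>
    (tw_level_up f uf huf hfev x).trans (by norm_num)
  have hΦ' : forrelation g f = forrelation f g := by
    rw [Summit.QuantumAdvantage.QuantumAdvantage.Theorems.SignedCubicForrelationNotPrBPP.Negative.HalfQuad.forrelation_comm]
  have h4 : ∀ y, 4 ∣ uf y := by
    intro y
    have h2 : ¬ Odd (uf y / 2) := fun hy =>
      tw15_levelFive_932_false g f hg hf (fun x => uf x / 2) huf5 ⟨y, hy⟩ (by rw [hΦ']; linarith)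
    have e1 := Int.not_odd_iff_even.1 (hfev y)
    have e2 := Int.not_odd_iff_even.1 h2
    obtain ⟨a, ha⟩ := e1
    obtain ⟨b, hb⟩ := e2
    omega
  -- `Ê(z) = 0` wherever `Ŝ(z) = 0`, `z ≠ 0`
  have hEhat0 : ∀ z, z ≠ zeroVec → ∑ x ∈ S, twist x z = 0 → ∑ x ∈ univ.filter (fun x => cE x = true), twist x z = 0 := by
    intro z hz hS0
    have hz' : ∃ i, z i = true := by
      by_contra hn
      push Not at hn
      exact hz (funext fun i => by simpa [zeroVec] using hn i)
    have h := hid (bxor c₁ z)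
    have hne : ¬ bxor c₁ (bxor c₁ z) = (fun _ => false) := by rw [bxor_bxor_cancel_left]; exact hz
    rw [if_neg hne, hvhat, bxor_bxor_cancel_left, hS0, ← hsetE] at h
    obtain ⟨t, ht⟩ := h4 (bxor c₁ z)
    have ht' : (uf (bxor c₁ z) : ℝ) = 4 * (t : ℝ) := by exact_mod_cast ht
    refine to18_char_sum_912_dvd64 cE hcE3 hcEcard z hz' (sZ b₁ * (t - sZ (g (bxor c₁ z)))) ?_
    push_cast
    rw [tp_sZ_cast, tp_sZ_cast]
    rw [ht'] at h
    linear_combination (-(signOf b₁) / 4) * h +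
      (-(∑ x ∈ univ.filter (fun x => cE x = true), twist x z)) * hsb2
  -- where `Ŝ(z) ≠ 0`, all of `S` is on one side of `z`
  have hSconst : ∀ z, ∑ x ∈ S, twist x z ≠ 0 → ∀ x₁ ∈ S, ∀ x₂ ∈ S, twist x₁ z = twist x₂ z := by
    intro z hne x₁ hx₁ x₂ hx₂
    rcases hShat z with h | h | h
    · exact absurd h hne
    · have hsum : ∑ x ∈ S, (1 - twist x z) = 0 := by rw [sum_sub_distrib, sum_const, hS8, h]; norm_num
      have hnn : ∀ x ∈ S, (0 : ℝ) ≤ 1 - twist x z := fun x _ => by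
        rcases twist_eq_one_or x z with h' | h' <;> rw [h'] <;> norm_num
      have e := (sum_eq_zero_iff_of_nonneg hnn).1 hsum
      linarith [e x₁ hx₁, e x₂ hx₂]
    · have hsum : ∑ x ∈ S, (1 + twist x z) = 0 := by rw [sum_add_distrib, sum_const, hS8, h]; norm_num
      have hnn : ∀ x ∈ S, (0 : ℝ) ≤ 1 + twist x z := fun x _ => by
        rcases twist_eq_one_or x z with h' | h' <;> rw [h'] <;> norm_num
      have e := (sum_eq_zero_iff_of_nonneg hnn).1 hsum
      linarith [e x₁ hx₁, e x₂ hx₂]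
  -- periodicity of `E` under differences of points of `S`
  have hper : ∀ x₁ ∈ S, ∀ x₂ ∈ S, ∀ y, cE (bxor y (bxor x₁ x₂)) = cE y := by
    intro x₁ hx₁ x₂ hx₂ y
    have hkey : ∀ z, (∑ x ∈ univ.filter (fun x => cE x = true), twist x z) * twist z (bxor x₁ x₂) =
        ∑ x ∈ univ.filter (fun x => cE x = true), twist x z := by
      intro z
      by_cases hz : z = zeroVec
      · rw [hz, twist_comm zeroVec, twist_zeroVec_right, mul_one]
      by_cases hS0 : ∑ x ∈ S, twist x z = 0
      · rw [hEhat0 z hz hS0, zero_mul]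
      · rw [twist_bxor_right z x₁ x₂, twist_comm z x₁, twist_comm z x₂, hSconst z hS0 x₁ hx₁ x₂ hx₂]
        rcases twist_eq_one_or x₂ z with h | h <;> rw [h] <;> ring
    set G : (Fin (6 + 6) → Bool) → ℝ := fun x => if cE x = true then 1 else 0 with hGdef
    have hWG : ∀ z, W G z = ∑ x ∈ univ.filter (fun x => cE x = true), twist x z := by
      intro z
      unfold W
      rw [sum_filter]
      exact sum_congr rfl fun x _ => by simp only [G]; split_ifs <;> simp
    have h1 := tz_inversion G y
    have h2 := tz_inversion G (bxor y (bxor x₁ x₂))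
    have h3 : ∑ z, W G z * twist z (bxor y (bxor x₁ x₂)) = ∑ z, W G z * twist z y := by
      refine sum_congr rfl fun z _ => ?_
      rw [twist_bxor_right, hWG z, mul_left_comm, hkey z, mul_comm]
    have hG : G (bxor y (bxor x₁ x₂)) = G y := by
      have h := h2.symm.trans (h3.trans h1)
      exact mul_left_cancel₀ (by positivity) h
    simp only [G] at hG
    rcases Bool.eq_false_or_eq_true (cE (bxor y (bxor x₁ x₂))) with ha | ha <;>
      rcases Bool.eq_false_or_eq_true (cE y) with hb | hb <;> simp only [ha, hb] at hG ⊢ <;> norm_num at hG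
  -- three points of `S`, two distinct non-zero periods
  have h3S : 2 < #S := by rw [hS8]; norm_num
  obtain ⟨x₁, x₂, x₃, hx₁, hx₂, hx₃, h12, h13, h23⟩ := two_lt_card_iff.1 h3S
  refine to18_no_two_periods_912 cE hcE3 hcEcard (bxor x₁ x₂) (bxor x₁ x₃) ?_ ?_ ?_ (hper x₁ hx₁ x₂ hx₂) (hper x₁ hx₁ x₃ hx₃)
  · intro h
    apply h12
    funext i
    have := congrFun h i
    change (x₁ i ^^ x₂ i) = false at this
    revert this
    cases x₁ i <;> cases x₂ i <;> simp
  · intro h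
    apply h13
    funext i
    have := congrFun h i
    change (x₁ i ^^ x₃ i) = false at this
    revert this
    cases x₁ i <;> cases x₃ i <;> simp
  · intro h
    apply h23
    funext i
    have := congrFun h i
    change (x₁ i ^^ x₂ i) = (x₁ i ^^ x₃ i) at this
    revert this
    cases x₁ i <;> cases x₂ i <;> cases x₃ i <;> simp

/-- **A type-O side has `Φ < 934/1024`** (12 bits). NOT summit progress. [this work] -/
theorem to18_typeO_lt_934 (f g : (Fin (6 + 6) → Bool) → Bool) (hf : IsDegLeFun 3 f) (hg : IsDegLeFun 3 g)
    (u : (Fin (6 + 6) → Bool) → ℤ) (hu : ∀ x, W (fun y => signOf (g y)) x = (2 : ℝ) ^ 4 * (u x : ℝ))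
    (hodd : ∃ x, Odd (u x)) : forrelation f g < 934 / 1024 := by
  by_contra h
  exact to18_typeO_ge934_false f g hf hg u hu hodd (le_of_not_gt h)

end Summit.QuantumAdvantage.QuantumAdvantage.Theorems.CubicForrelation.NearExactIsExact

end
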